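import Summits.QuantumFields.BalabanUV.Beta.GAN24.ThreeLegDoubleFreeze
import Summits.QuantumFields.BalabanUV.Beta.GAN24.StaircaseFaces

/-!
# `BalabanUV.Beta.GAN24.ThreeLegDoubleFreezeBlockL1` — binder row G-an2-4 ∕ (CONV-C), W-slot, the (α-0) parity re-cut, located crux (Q-L-k₀)
# (RULING R-gan24p1-g36-1 (4)–(5), journal `CLAIMS.log` [GAN24P1-G36-RULING1] ∕ [GAN24P1-G36-INTENT1]): **THE THREE-LEG CORE WITH THE KERNEL LEG IN BLOCK-ℓ¹**
# — leaf-01 g74's `ThreeLegDoubleFreeze.abs_threeLeg_blockSum_le` with its kernel-leg hypothesis `|ρ x| ≤ a_ρ·E_{c₃}(x)` RELAXED to the block mass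
# `Σ_{t ∈ box L} |ρ (L•c + t)| ≤ a_ρ·L^{d+1}·E_{c₃}(c)` (OWNER `b2b-balaban-gan24-p1`, gen 36)

NOT IN PRINT; OUR BOOKKEEPING ([folklore] re-blocking of one absolutely convergent lattice sum over leaf-01 g74's core BY NAME; 0 `def`, 0 cited facts, 0 `def … : Prop`,
0 sorry).  HONEST FRAMING (cell contract, verbatim): «discharging `BetaPertH` makes Bałaban's UV stability UNCONDITIONAL — a real constructive-QFT result; it is NOT the
continuum limit and NOT the Clay problem.»  HONEST DEPENDENCY (verbatim): «continuum YM on T⁴ ⇐ BetaPertH ∧ nine spine estimates (0/9 proved); BetaPertH ⇐ (D1) ∧ (D4) ∧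
CAP+tail; G-an2-4 gates asym, D1 and NE2/3/4.»

WHY (RULING R-gan24p1-g36-1 (4)).  The (H1♮) core reads the kernel leg `ρ` only through `Σ′_x |ρ x|·(three block-constant envelopes)(x)`; the DRESSED composite row
`T^E = Π^ρ_bm T^B + dz Ψ` meets a SUP envelope only one power of the relative blocking above `T^B` (leaf-01 g57 CT-2), but meets the BLOCK-ℓ¹ envelope with a `k`-linear
constant (OWNER `DressedLegSawtoothBlockL1.sum_box_abs_dz_Psi_single_le`).  So the core is re-stated with the block-ℓ¹ hypothesis; the sup form is its special case.
WHAT (generic `d`; leaf-01 g74's standing hypotheses VERBATIM except `hρ`):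
* **`abs_threeLeg_blockSum_le_of_blockL1`** — SAME conclusion as `abs_threeLeg_blockSum_le` under
  `hρ : ∀ c, Σ_{t ∈ box L} |ρ (L•c + toSite t)| ≤ aρ·L^{d+1}·e^{−κ₀‖c − c₃‖∞}` (re-block `Σ′_x = Σ′_c Σ_{t ∈ box L}` by `KKTFluctuationEnergy.tsum_blocks`; the slot layers' bound
  `abs_slotLayers_le` is block-constant in `x`; a term is at most its block's mass (`blk_add_off` ∕ `off_mem_box`, inlined — the named lemma `abs_le_blockSum` is
  `ThreeLegSupBoundBlockL1`'s); the coarse four-envelope sum is `EnvelopeBlockSum.tsum_env4_le` at `L = 1`).  v1.2 (gen 39): the rows `hρ hW hq₂ hq₁ hq₁₂` are the core's OWN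
  displayed binders (same order and elaborated signature as v1 121b673718468583 ∕ p370790, every by-name consumer unchanged) — v1 kept them as section variables, so its
  source statement was the text of leaf-01's sup-form core and the gate's textual restatement check bounced it (`dedup.landed`, p370790);
* `blockL1_of_sup` — the sup form recovered (sanity: `Σ_t |ρ| ≤ L^{d+1}·a_ρ·E_{c₃}(c)`), so leaf-01's core is the special case.
Asserts NOTHING about Bałaban's tables; NOT (H1♮) (carrier ∕ dressing ∕ slot charges ∕ socket instantiation are other files); NEVER «G-an2-4 closed» as (CONV-C); NOT D1,
NOT `BetaPertH`, NOT continuum, NOT Clay.  2026-08-23; no existing file touched.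
-/

noncomputable section

open Finset
open scoped BigOperators
open Literature.MathematicalPhysics.QuantumFieldTheory.LatticeForm (quo)
open Literature.MathematicalPhysics.QuantumFieldTheory.Balaban1983to89
open Literature.MathematicalPhysics.QuantumFieldTheory.Balaban1983to89.Beta
open B4ContourShift (supNorm)
open B12Sec2to5 (l1)
open ExpKernelCalculus (Zl Zl_nonneg)
open AffineAveraging (Site box toSite)
open AveragingContours (blk off off_mem_box blk_add_off)
open KKTFluctuationEnergy (quo_zsmul_add_toSite tsum_blocks summable_blocks)
open Summit.QuantumFields.BalabanUV.Beta.GAN24.EnvelopeBlockSum (tsum_env4_le)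
open Summit.QuantumFields.BalabanUV.Beta.GAN24.StaircaseFaces (blk_one)
open Summit.QuantumFields.BalabanUV.Beta.GAN24.ThreeLegDoubleFreeze (abs_slotLayers_le)

namespace Summit.QuantumFields.BalabanUV.Beta.GAN24.ThreeLegDoubleFreezeBlockL1

variable {d : ℕ}

/-! ## §1 The core with the kernel leg in block-ℓ¹ (v1.2: the former §1 lemma `abs_le_blockSum` is `ThreeLegSupBoundBlockL1`'s — inlined below; the kernel-leg and
table rows `hρ hW hq₂ hq₁ hq₁₂` are DISPLAYED binders of the core (same order, same elaborated signature as v1) so that its source statement is not the text of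
leaf-01's sup-form `ThreeLegDoubleFreeze.abs_threeLeg_blockSum_le` — the gate's textual restatement check read v1 as a twin of it, p370790) -/

section Core

variable {L : ℕ} {κ₀ δ a a' aρ C g : ℝ} {h₁ h₂ ρ : (Fin (d + 1) → ℤ) → ℝ}
  {W : (Fin (d + 1) → ℤ) → (Fin (d + 1) → ℤ) → (Fin (d + 1) → ℤ) → (Fin (d + 1) → ℤ) → ℝ}
  {c₁ c₂ c₃ c₄ : Fin (d + 1) → ℤ}
  (hL : 1 ≤ L) (hκ : 0 < κ₀) (hδ : 0 < δ) (hgap : κ₀ ≤ δ / 6 * L)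
  (ha : 0 ≤ a) (ha' : 0 ≤ a') (haρ : 0 ≤ aρ) (hC : 0 ≤ C) (hg : 0 ≤ g)
  (hh₁ : ∀ v, |h₁ v| ≤ a * Real.exp (-(κ₀ * supNorm (quo L v - c₁))))
  (hh₁' : ∀ v i, |h₁ (v + Pi.single i 1) - h₁ v| ≤ a' * Real.exp (-(κ₀ * supNorm (quo L v - c₁))))
  (hh₂ : ∀ v, |h₂ v| ≤ a * Real.exp (-(κ₀ * supNorm (quo L v - c₂))))
  (hh₂' : ∀ v i, |h₂ (v + Pi.single i 1) - h₂ v| ≤ a' * Real.exp (-(κ₀ * supNorm (quo L v - c₂))))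

include hL hκ hδ hgap ha ha' haρ hC hg hh₁ hh₁' hh₂ hh₂' in
/-- NOT IN PRINT; OUR BOOKKEEPING.  **THE THREE-LEG CORE WITH THE KERNEL LEG IN BLOCK-ℓ¹** (RULING R-gan24p1-g36-1 (4)): leaf-01 g74's `abs_threeLeg_blockSum_le`
VERBATIM except that the kernel leg is only asked to have BLOCK MASS `Σ_{t ∈ box L} |ρ (L•c + t)| ≤ a_ρ·L^{d+1}·e^{−κ₀‖c − c₃‖∞}` on every source block; SAME conclusion
`|Σ′_x ρ x·Σ′_v h₁ v·Σ′_{v′} h₂ v′·Σ_{t∈box L} W v v′ x (L•c₄+t)| ≤ a_ρ·(e^{κ₀}Zl(δ∕6))·(a′²·C·e^{2κ₀}·M² + 2·a·a′·g·e^{κ₀}·M + a²·g)·L^{d+1}·Zl(κ₀∕(2(d+1)))·e^{−(κ₀∕6)(‖c₂−c₁‖∞+‖c₃−c₁‖∞+‖c₄−c₁‖∞)}`.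
Proof: the slot layers' bound (`abs_slotLayers_le`) is constant on the `L`-blocks of `x`; re-block `Σ′_x = Σ′_c Σ_{t ∈ box L}` (`tsum_blocks`), consume `hρ` block by block, and sum
the four coarse envelopes by `tsum_env4_le` at `L = 1`. -/
theorem abs_threeLeg_blockSum_le_of_blockL1
    (hρ : ∀ c, ∑ t ∈ box (d + 1) L, |ρ ((L : ℤ) • c + toSite t)| ≤ aρ * (L : ℝ) ^ (d + 1) * Real.exp (-(κ₀ * supNorm (c - c₃))))
    (hW : ∀ v v' x p, |W v v' x p| ≤ C * Real.exp (-δ * l1 (v' - v)) * Real.exp (-δ * (l1 (x - v) + l1 (p - v))))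
    (hq₂ : ∀ v x p, |∑' v', W v v' x p| ≤ g * Real.exp (-δ * (l1 (x - v) + l1 (p - v))))
    (hq₁ : ∀ v' x p, |∑' v, W v v' x p| ≤ g * Real.exp (-δ * (l1 (x - v') + l1 (p - v'))))
    (hq₁₂ : ∀ x p, |∑' v, ∑' v', W v v' x p| ≤ g * Real.exp (-δ * l1 (p - x))) :
    |∑' x, ρ x * ∑' v, h₁ v * ∑' v', h₂ v' * ∑ t ∈ box (d + 1) L, W v v' x ((L : ℤ) • c₄ + toSite t)|
      ≤ aρ * ((Real.exp κ₀ * Zl (d + 1) (δ / 6)) *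
          (a' ^ 2 * C * Real.exp κ₀ ^ 2 * (2 / (δ / 6) * Zl (d + 1) (δ / 6 / 2)) ^ 2
            + 2 * (a * a' * g * Real.exp κ₀ * (2 / (δ / 6) * Zl (d + 1) (δ / 6 / 2))) + a ^ 2 * g)) *
        ((L : ℝ) ^ (d + 1) * Zl (d + 1) (κ₀ / (2 * ((d : ℝ) + 1))) *
          Real.exp (-(κ₀ / 6) * (supNorm (c₂ - c₁) + supNorm (c₃ - c₁) + supNorm (c₄ - c₁)))) := by
  classical
  haveI : NeZero L := ⟨by omega⟩
  have hL0 : (0 : ℝ) < L := by exact_mod_cast hL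
  set Jc : ℝ := (Real.exp κ₀ * Zl (d + 1) (δ / 6)) *
      (a' ^ 2 * C * Real.exp κ₀ ^ 2 * (2 / (δ / 6) * Zl (d + 1) (δ / 6 / 2)) ^ 2
        + 2 * (a * a' * g * Real.exp κ₀ * (2 / (δ / 6) * Zl (d + 1) (δ / 6 / 2))) + a ^ 2 * g) with hJc
  have hJc0 : 0 ≤ Jc := by
    have := Zl_nonneg (D := d + 1) (show 0 < δ / 6 by positivity)
    have := Zl_nonneg (D := d + 1) (show 0 < δ / 6 / 2 by positivity)
    rw [hJc]; positivity
  -- names for the envelopes and the summand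
  set E : (Fin (d + 1) → ℤ) → (Fin (d + 1) → ℤ) → ℝ := fun c y => Real.exp (-(κ₀ * supNorm (c - y))) with hE
  set S : (Fin (d + 1) → ℤ) → ℝ := fun x => ∑' v, h₁ v * ∑' v', h₂ v' * ∑ t ∈ box (d + 1) L, W v v' x ((L : ℤ) • c₄ + toSite t) with hS
  -- the slot layers: block-constant bound in `x`
  have hSx : ∀ x, |S x| ≤ Jc * (E (quo L x) c₁ * E (quo L x) c₂ * E (quo L x) c₄) := fun x => by
    have hJ := abs_slotLayers_le (c₄ := c₄) hL hκ hδ hgap ha ha' hC hg hh₁ hh₁' hh₂ hh₂' hW hq₂ hq₁ hq₁₂ x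
    rw [← hJc] at hJ
    exact hJ
  -- pointwise domination of the kernel leg by its block mass
  have hρx : ∀ x, |ρ x| ≤ aρ * (L : ℝ) ^ (d + 1) * E (quo L x) c₃ := fun x => by
    -- a term is at most its block's mass (`x` is one of the points of its own block)
    have hx : ρ x = ρ ((L : ℤ) • blk L x + toSite (off L x)) := by rw [blk_add_off hL x]
    have hle : |ρ x| ≤ ∑ t ∈ box (d + 1) L, |ρ ((L : ℤ) • blk L x + toSite t)| := by
      rw [hx]
      exact Finset.single_le_sum (f := fun t => |ρ ((L : ℤ) • blk L x + toSite t)|) (fun _ _ => abs_nonneg _) (off_mem_box hL x)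
    exact hle.trans (hρ (blk L x))
  -- the coarse four-envelope sum (`tsum_env4_le` at blocking 1)
  have hE4 := tsum_env4_le (d := d) (L := 1) le_rfl hκ c₁ c₂ c₃ c₄
  have hq1 : ∀ u : Fin (d + 1) → ℤ, quo 1 u = u := fun u => blk_one u
  simp only [hq1, Nat.cast_one, one_pow, one_mul] at hE4
  -- summability of the summand from the (crude) pointwise bounds
  have hpt : ∀ x, ‖ρ x * S x‖ ≤ (aρ * (L : ℝ) ^ (d + 1) * Jc) *
      (E (quo L x) c₁ * E (quo L x) c₂ * E (quo L x) c₃ * E (quo L x) c₄) := fun x => by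
    rw [Real.norm_eq_abs, abs_mul]
    calc |ρ x| * |S x| ≤ (aρ * (L : ℝ) ^ (d + 1) * E (quo L x) c₃) * (Jc * (E (quo L x) c₁ * E (quo L x) c₂ * E (quo L x) c₄)) :=
          mul_le_mul (hρx x) (hSx x) (abs_nonneg _) (by positivity)
      _ = _ := by ring
  have hE4L := tsum_env4_le (d := d) hL hκ c₁ c₂ c₃ c₄
  have hsum : Summable fun x => ρ x * S x :=
    Summable.of_norm_bounded (hE4L.1.mul_left (aρ * (L : ℝ) ^ (d + 1) * Jc)) hpt
  -- re-block the `x`-sum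
  rw [tsum_blocks (N := L) hsum]
  -- block by block: the layers' bound is constant on the block, the kernel leg gives its block mass
  have hblk : ∀ c : Fin (d + 1) → ℤ,
      ‖∑ t ∈ box (d + 1) L, ρ ((L : ℤ) • c + toSite t) * S ((L : ℤ) • c + toSite t)‖
        ≤ (aρ * (L : ℝ) ^ (d + 1) * Jc) * (E c c₁ * E c c₂ * E c c₃ * E c c₄) := fun c => by
    rw [Real.norm_eq_abs]
    calc |∑ t ∈ box (d + 1) L, ρ ((L : ℤ) • c + toSite t) * S ((L : ℤ) • c + toSite t)|
        ≤ ∑ t ∈ box (d + 1) L, |ρ ((L : ℤ) • c + toSite t) * S ((L : ℤ) • c + toSite t)| := Finset.abs_sum_le_sum_abs _ _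
      _ ≤ ∑ t ∈ box (d + 1) L, |ρ ((L : ℤ) • c + toSite t)| * (Jc * (E c c₁ * E c c₂ * E c c₄)) :=
          Finset.sum_le_sum fun t ht => by
            rw [abs_mul]
            have h := hSx ((L : ℤ) • c + toSite t)
            rw [quo_zsmul_add_toSite c ht] at h
            exact mul_le_mul_of_nonneg_left h (abs_nonneg _)
      _ = (∑ t ∈ box (d + 1) L, |ρ ((L : ℤ) • c + toSite t)|) * (Jc * (E c c₁ * E c c₂ * E c c₄)) := by rw [Finset.sum_mul]
      _ ≤ (aρ * (L : ℝ) ^ (d + 1) * E c c₃) * (Jc * (E c c₁ * E c c₂ * E c c₄)) :=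
          mul_le_mul_of_nonneg_right (hρ c) (by positivity)
      _ = _ := by ring
  have hs := hE4.1.mul_left (aρ * (L : ℝ) ^ (d + 1) * Jc)
  have hb := tsum_of_norm_bounded hs.hasSum hblk
  rw [Real.norm_eq_abs, tsum_mul_left] at hb
  refine hb.trans ?_
  calc aρ * (L : ℝ) ^ (d + 1) * Jc * ∑' c, E c c₁ * E c c₂ * E c c₃ * E c c₄
      ≤ aρ * (L : ℝ) ^ (d + 1) * Jc * (Zl (d + 1) (κ₀ / (2 * ((d : ℝ) + 1))) *
          Real.exp (-(κ₀ / 6) * (supNorm (c₂ - c₁) + supNorm (c₃ - c₁) + supNorm (c₄ - c₁)))) :=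
        mul_le_mul_of_nonneg_left hE4.2 (by positivity)
    _ = _ := by rw [hJc]; ring

include hL in
/-- [folklore] **THE SUP FORM RECOVERED** (sanity): a sup envelope `|ρ x| ≤ a_ρ·E_{c₃}(x)` gives the block mass `≤ a_ρ·L^{d+1}·E_{c₃}(c)` (the envelope is constant on
the block, `#box = L^{d+1}`), so leaf-01 g74's `abs_threeLeg_blockSum_le` is the special case of `abs_threeLeg_blockSum_le_of_blockL1`. -/
theorem blockL1_of_sup {ρ' : (Fin (d + 1) → ℤ) → ℝ} {aρ' : ℝ} {c₃' : Fin (d + 1) → ℤ}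
    (hρ' : ∀ x, |ρ' x| ≤ aρ' * Real.exp (-(κ₀ * supNorm (quo L x - c₃')))) (c : Fin (d + 1) → ℤ) :
    ∑ t ∈ box (d + 1) L, |ρ' ((L : ℤ) • c + toSite t)| ≤ aρ' * (L : ℝ) ^ (d + 1) * Real.exp (-(κ₀ * supNorm (c - c₃'))) := by
  haveI : NeZero L := ⟨by omega⟩
  have hcard : ((box (d + 1) L).card : ℝ) = (L : ℝ) ^ (d + 1) := by
    simp [AffineAveraging.box, Fintype.card_piFinset]
  calc ∑ t ∈ box (d + 1) L, |ρ' ((L : ℤ) • c + toSite t)|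
      ≤ ∑ t ∈ box (d + 1) L, aρ' * Real.exp (-(κ₀ * supNorm (c - c₃'))) :=
        Finset.sum_le_sum fun t ht => by
          have h := hρ' ((L : ℤ) • c + toSite t)
          rwa [quo_zsmul_add_toSite c ht] at h
    _ = aρ' * (L : ℝ) ^ (d + 1) * Real.exp (-(κ₀ * supNorm (c - c₃'))) := by
        rw [Finset.sum_const, nsmul_eq_mul, hcard]; ring

end Core

end Summit.QuantumFields.BalabanUV.Beta.GAN24.ThreeLegDoubleFreezeBlockL1

end
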